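import Literature.NumberTheory.LFunctions.Zhang2022.RepairRplusPlus3
import Literature.NumberTheory.LFunctions.Zhang2022.RepairBlenNuLipschitz
import Literature.NumberTheory.LFunctions.Zhang2022.RepairTrueBand
import Literature.NumberTheory.LFunctions.Zhang2022.RepairSmoothTrueBand

/-!
# Zhang (2022) §18-margin repair rung — THE RUNNING ASSEMBLY `R⁺⁺`, continuation file (versions 9, …)

Trunk T-ANT (NumberTheory/LFunctions). Y. Zhang, *Discrete mean estimates and the Landau–Siegel
zero*, arXiv:2211.02515v1 (2022) [Zhang2022LandauSiegel] — **an unrefereed manuscript under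
adjudication. WHAT THIS IS NOT: nothing here asserts or denies its Theorems 1–2 or any analytic lemma;
no claim about Landau–Siegel zeros, about Parity, or about a repaired `Margin232` is made. Every
statement is about the manuscript's METHOD AS ARCHITECTED — classes of designs fed to the SAME main-term
calculus (or to a displayed MODEL main term) — not about zeros of `L`-functions.** Cell `landau-siegel`
(rung F-S3), sub-cell E, seat p1 (generation g2), stub S-E-p1-1 «running assembly» of barrier/ASSIGNMENTS.md.

Continuation of `RepairRplusPlus` (versions 0–3), `RepairRplusPlus2` (versions 4–6 + addendum) and `RepairRplusPlus3`
(versions 7–8; class of record before this file = `Repair.Rplusplus8`, p470204, 33 families, with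
`bmultiWord6_sub_rplusplus8` / `blenWord2_sub_rplusplus8`); those files reached their line budget. Same protocol
(`Repair.DesignFamily`, `ClassDecided`, append-only versions `Rplusplus<k>`, class OF RECORD = the last version,
named in barrier/BARRIER-STATE.md; per version: `Rplusplus<k>`, `rplusplus<k>_decided` by `classDecided_append` —
nothing re-proved —, `mem_rplusplus<k>_iff`, the prefix lemma, the sub-list recoveries, the intake lists of record as
sub-lists, the unbundled verdicts, and the table rows in a `/-! ### Version k -/` section).

## Class table — version 9 (row 34; rows 1–14 `RepairRplusPlus`, 15–21 `RepairRplusPlus2`, 22–33 `RepairRplusPlus3`)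

| # | family (decl) | designs, K in words | V (currency) | displayed inputs (kind) | p-id (file) | non-vacuity / tightness / embeddings |
|---|---|---|---|---|---|---|
| 34 «(L-b)∣νψ Lipschitz» | `familyNuLipOverhangAll` | `NuLipDesign (θ, K, v)`: `1 < θ < 2`, `LipschitzWith K v`, `v = 0` off `[1,θ]` (hence `v(1) = v(θ) = 0`) — the LIPSCHITZ sub-class of row 30's `bvOverhang θ` (by term `NuLipDesign.InClass.bvOverhang`, `.toNuDesign`); coefficients `(1∗χ)(n)ψ(n)·v(z_n)` on `P ≤ n < P^θ`, glued to ANY bulk table `F` (quantified in the verdict) — B-len (L-b) «νψ = (1∗χ)ψ·v(z_n)»; the 36 continuous `len-nu-*` rows of record | RELATIVE discrete-mean currency (E-003 / row 4 shape): for every shift `c′`, eventually in `D`, for every real primitive `χ`, under (b), for EVERY `F`: `¬ (δ·(Ξ(F) + discWeight) + δ²·discWeight < |Ξ(F + A_ν) − Ξ(F)|)`, `δ = 4K·𝓛^{−180}` | `Re ρ = ½` and `Re 𝔠*·Re ω ≥ 0` on `Skeleton.idx χ` (kind (b): Prop. 2.2 (i) / Lemma 2.3 outputs) ONLY — **NO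 slot** | p470276 (`RepairBlenNuLipschitz`, ls-Blen-typer-2 g2, S-E-bt2-2) ← p468144 (`abs_discMean_add_nuPoly_sub_le`: Zhang's own (4.8) partial summation on `Ψ₁`) | **DECIDED BY THEOREM** — on this sub-class row 30's slot E-074′ is a kernel theorem, and `nuMeanInvisible_lipOverhang_frakA` DISCHARGES row 30's `NuMeanInvisible` at the scale `𝔞` from Prop71/Lemma81/Prop22i/Lemma23 (`familyNuOverhang_conclusion_of_nuLip`); C2 `NuLipDesign.InClass.toNuDesign` (⊂ row 30), `inClass_zero`; C4 `inClass_nuLipBump_54` / `_2120` (`nuLipBump θ = polyProf θ (bumpPoly θ)`, the same profile term as row 30's `lenNuBump θ`), `inClass_nuLipTent`, `nuLip_examples`; NOT covered here: the 12 rampcut JUMP rows (row 30, conditional), the ν VARIANTS (statement only) |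

C1 NOTES carried: rows 29–30 — author-side PASS (ls-Blen-plan g2 21:21:34Z), REF-E E-16/E-17 pending; row 34 — REF-E entry
pending (kind: extension WITHOUT slot); the B-len intake of record is now `Repair.blenWord3` (RepairIntakeBlen Part 6:
`blenWord2 ++ [familyNuLipOverhangAll]`; sum family `familyBlen3` with constructor `nuLip`) — a sub-list of version 9
(`blenWord3_sub_rplusplus9`), as is `Repair.bmultiWord6` (`bmultiWord6_sub_rplusplus9`). KILL(B-det), KILL(B-ell): words
pending; KILL(B-fam): `bfamWord` disjoint by declaration, never a row; KILL(B-dh): `DH.menuConsistent_holds` (E-18), not a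
row. This file records the running UNION, not the words. IMPORT RULE: the assembly imports slice and intake files, never
conversely.

## References

* Y. Zhang, arXiv:2211.02515v1 (2022), §2 Lemma 2.3, Props. 2.2, 2.4–2.6, (2.16)–(2.20), (2.32)–(2.33) [p. 4–11],
  §3 (3.4)–(3.6), §4 (4.8) [p. 20], §7 Prop. 7.1, (7.2) [p. 44], §8 Lemma 8.1.
  [cite: Zhang2022LandauSiegel, §§2, 3, 4, 7, 8]
-/

noncomputable section

open scoped ComplexOrder NNReal

namespace Literature.NumberTheory.LFunctions.Zhang2022

namespace Repair

/-! ### Version 9 (2026-08-26): the DECIDED Lipschitz νψ row; the B-len intake v3 inside the class of record -/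

/-- **`R⁺⁺`, version 9**: version 8 (`RepairRplusPlus3.Rplusplus8`, 33 families) followed by the Lipschitz νψ-overhang
family (`familyNuLipOverhangAll`, p470276) — row 34 of the table above, decided by theorem with no slot.
[cite: Zhang2022LandauSiegel, §2 (2.16), (2.32)–(2.33); §4 (4.8) p. 20] -/
def Rplusplus9 : List DesignFamily := Rplusplus8 ++ [familyNuLipOverhangAll]

/-- **Version 9 is decided**: `rplusplus8_decided` for rows 1–33 and `familyNuLipOverhangAll_decided` (p470276) for
row 34; nothing re-proved. [cite: Zhang2022LandauSiegel, §2 Props. 2.4–2.6, (2.16), (2.32)–(2.33); §4 (4.8)] -/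
theorem rplusplus9_decided : ClassDecided Rplusplus9 :=
  classDecided_snoc rplusplus8_decided familyNuLipOverhangAll_decided

/-- The families of version 9, by name (the class is EXACTLY these thirty-four).
[cite: Zhang2022LandauSiegel, §2 (2.32)–(2.33)] -/
theorem mem_rplusplus9_iff (F : DesignFamily) :
    F ∈ Rplusplus9 ↔ F = familyR ∨ F = familyH1 ∨ F = familyTwoPiece ∨ F = familyFarPiece ∨
      F = familyRWide ∨ F = familyRCalc ∨ F = KnifeEdge.familyRoughTwoPiece ∨ F = familyRLengths ∨
      F = familySmoothLengths ∨ F = familySmoothTop ∨ F = familyTwoPieceJoint ∨ F = familyWallZero ∨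
      F = familyWallZeroTop ∨ F = familyInPrintLen ∨ F = KnifeEdge.familyWallBand ∨ F = familyJumpBlockAll ∨
      F = familyDetShift ∨ F = KnifeEdge.familyRoughThreePiece ∨ F = KnifeEdge.familyRoughTwoPieceJoint ∨
      F = familyFarBV ∨ F = familyLambdaBlockAll ∨ F = familyWallZeroMain ∨ F = familyWallZeroTopMain ∨
      F = KnifeEdge.familyGramBlockAll ∨ F = familyLambdaOverhangAll ∨ F = familyLambdaGradedAll ∨
      F = KnifeEdge.familyGramBlockDict ∨ F = KnifeEdge.familyGramBordered ∨ F = familyMuPsiOverhangAll ∨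
      F = familyNuOverhangAll ∨ F = familyBandEdge ∨ F = familySmoothBandEdge ∨ F = familySmoothTopBandEdge ∨
      F = familyNuLipOverhangAll := by
  simp only [Rplusplus9, Rplusplus8, Rplusplus7, Rplusplus6, Rplusplus5, Rplusplus4, Rplusplus3, Rplusplus2, Rplusplus1,
    Rplus, List.cons_append, List.nil_append, List.mem_cons, List.not_mem_nil, or_false]

/-- **Version 8 ⊆ version 9** (list prefix: no family dropped). [cite: Zhang2022LandauSiegel, §2 (2.32)–(2.33)] -/
theorem rplusplus8_sub_rplusplus9 : ∀ F ∈ Rplusplus8, F ∈ Rplusplus9 :=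
  fun _ hF => List.mem_append.2 (Or.inl hF)

/-- `R⁺ ⊆` version 9. [cite: Zhang2022LandauSiegel, §2 (2.32)–(2.33)] -/
theorem rplus_sub_rplusplus9 : ∀ F ∈ Rplus, F ∈ Rplusplus9 :=
  fun F hF => rplusplus8_sub_rplusplus9 F (rplus_sub_rplusplus8 F hF)

/-- Version 9 restricted to version 8, and the slice file's own `R⁺ ++ [familyNuLipOverhangAll]`
(`rplus_nuLipOverhangAll_decided`) as a sub-list. [cite: Zhang2022LandauSiegel, §2 (2.32)–(2.33)] -/
theorem rplusplus9_decided_sublists :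
    ClassDecided Rplusplus8 ∧ ClassDecided (Rplus ++ [familyNuLipOverhangAll]) := by
  refine ⟨rplusplus9_decided.mono rplusplus8_sub_rplusplus9, rplusplus9_decided.mono fun F hF => ?_⟩
  rcases List.mem_append.1 hF with h | h
  · exact rplus_sub_rplusplus9 F h
  · exact List.mem_append.2 (Or.inr h)

/-- **The KILL(B-multi) intake list v6 is inside version 9** (inherited). [cite: Zhang2022LandauSiegel, §2 (2.32)–(2.33)] -/
theorem bmultiWord6_sub_rplusplus9 : ∀ F ∈ bmultiWord6, F ∈ Rplusplus9 :=
  fun F hF => rplusplus8_sub_rplusplus9 F (bmultiWord6_sub_rplusplus8 F hF)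

/-- **The KILL(B-len) intake list v3 is inside version 9**: every family of `blenWord3` (RepairIntakeBlen Part 6:
`blenWord2 ++ [familyNuLipOverhangAll]`) is a family of `Rplusplus9`.
[cite: Zhang2022LandauSiegel, §2 (2.32)–(2.33); §4 (4.8)] -/
theorem blenWord3_sub_rplusplus9 : ∀ F ∈ blenWord3, F ∈ Rplusplus9 := by
  intro F hF
  rcases List.mem_append.1 hF with h | h
  · exact rplusplus8_sub_rplusplus9 F (blenWord2_sub_rplusplus8 F h)
  · exact List.mem_append.2 (Or.inr h)

/-- … hence `blenWord3_decided` is an instance of `rplusplus9_decided`. [cite: Zhang2022LandauSiegel, §2 (2.32)–(2.33)] -/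
theorem rplusplus9_decided_blenWord3 : ClassDecided blenWord3 := rplusplus9_decided.mono blenWord3_sub_rplusplus9

/-- **Both words at once (v6 + v3)**: the union of the two intake lists of record is decided, as a sub-list of version 9.
[cite: Zhang2022LandauSiegel, §2 (2.32)–(2.33); §7 Prop 7.1 (7.2) p.44] -/
theorem rplusplus9_decided_words : ClassDecided (bmultiWord6 ++ blenWord3) := by
  refine rplusplus9_decided.mono fun F hF => ?_
  rcases List.mem_append.1 hF with h | h
  · exact bmultiWord6_sub_rplusplus9 F h
  · exact blenWord3_sub_rplusplus9 F h

/-- … and the two words as ONE family each, v6 / v3: `R⁺ ++ [familyBmulti6, familyBlen3]` is decided.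
[cite: Zhang2022LandauSiegel, §2 (2.32)–(2.33)] -/
theorem rplus_words_asFamilies_decided_v3 : ClassDecided (Rplus ++ [familyBmulti6, familyBlen3]) :=
  classDecided_append.2 ⟨rplus_decided, classDecided_cons familyBmulti6_decided <|
    classDecided_cons familyBlen3_decided classDecided_nil⟩

/-- **Unbundled reading of row 34** (every binder literal): for every top `1 < θ < 2`, Lipschitz constant `K`,
profile `v` that is `K`-Lipschitz and vanishes off `[1,θ]`, and every shift `c′`: eventually in `D`, for every real
primitive `χ`, under the two displayed (b)-hypotheses, for EVERY bulk table `F`, gluing the νψ-overhang moves the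
discrete mean by at most `δ·(Ξ(F) + discWeight) + δ²·discWeight`, `δ = 4K·𝓛^{−180}` — no slot.
[cite: Zhang2022LandauSiegel, §2 (2.16)–(2.17), Lemma 2.3, Prop. 2.2 (i); §3 (3.5); §4 (4.8)] -/
theorem rplusplus9_verdict_nuLip (θ : ℝ) (K : ℝ≥0) (v : ℝ → ℂ) (hθ1 : 1 < θ) (hθ2 : θ < 2)
    (hv : LipschitzWith K v) (hz : ∀ z, z < 1 ∨ θ < z → v z = 0) (c' : ℝ) :
    Skeleton.ForAllLarge fun D _ χ =>
      (∀ i ∈ Skeleton.idx χ, (i.2).re = 1 / 2) →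
        (∀ i ∈ Skeleton.idx χ, 0 ≤ (Skeleton.cstar c' D i.1 i.2).re * (Skeleton.omegaW D i.2).re) →
          ∀ F : Skeleton.Chr D → ℂ → ℂ,
            ¬ ((NuLipDesign.mk θ K v).rate D * (KnifeEdge.discMean c' χ F + KnifeEdge.discWeight c' χ)
                  + (NuLipDesign.mk θ K v).rate D ^ 2 * KnifeEdge.discWeight c' χ <
                |KnifeEdge.discMean c' χ (fun x s => F x s + KnifeEdge.nuPoly χ x v ⌈Skeleton.bigP D ^ θ⌉₊ s)
                  - KnifeEdge.discMean c' χ F|) :=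
  familyNuLipOverhangAll_decided ⟨θ, K, v⟩ ⟨hθ1, hθ2, hv, hz⟩ c'

/-- **Rows 30 and 34 share members** (bookkeeping): every row-34 design is a row-30 design (`toNuDesign`, class
preserved), so coverage counts the 36 continuous rows ONCE under the stronger (slot-free) currency.
[cite: Zhang2022LandauSiegel, §7 (7.2) p.44] -/
theorem nuLip_into_nu (d : NuLipDesign) (h : familyNuLipOverhangAll.InClass d) :
    familyNuOverhangAll.InClass d.toNuDesign :=
  NuLipDesign.InClass.toNuDesign h

/-! ### Version 10 (2026-08-26): E-004 in its FINAL form — the TRUE-BAND wall-zero rows (p470415, ls-barrier-p2 g2)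

| # | family (decl) | designs, K in words | V (currency) | displayed inputs (kind) | p-id (file) | non-vacuity / tightness / embeddings |
|---|---|---|---|---|---|---|
| 35 «wall0, true band» | `familyWallZeroTrueBand` | `WallZeroDesign (c′, g)` = rows 12 / 22 UNCHANGED (`g` globally 1-Lipschitz, `‖g‖∞ ≤ 1`, `g(1) = 0`; smooth wall-zero profile, bulk-to-ANY-length) | discrete mean at the MAIN scale: ∀ `δ > 0` ∀ `A : ℕ` ∀ `η`, IF `DiscMeanTrueBand c′ (1058+2A) η` then eventually, under (b), for EVERY `⌈P⌉ ≤ N ≤ ⌈P^{1+δ}⌉`: `¬ (η·(discMeanAbs⌈P⌉ + 𝔞𝔓) + (𝓛^A)⁻¹·(discMeanAbs(bandEdge) + discWeight) < |discMean N − discMean ⌈P⌉|)` | ONE slot, kind (c): `Repair.DiscMeanTrueBand c′ m η` = E-004 ON THE TRUE `α̃`-BAND ONLY, `[⌈P⌉, ⌈D·P·𝓛^m⌉ + 1]`, at the main scale `𝔞𝔓` (every partial block of the band of a wall-zero 1-Lipschitz profile changes the discrete mean by `≤ η·(discMeanAbs⌈P⌉ + 𝔞𝔓)`); beyond the band edge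 NO slot — a theorem (rows 31–33, p469201/p469409/p470027, saving `𝓛^{−A}`) · `Re ρ = ½` (b) | p470415 (`RepairTrueBand`, ls-barrier-p2 g2) ← p470027, p459259 | **E-004 IN FINAL FORM**; SUPERSEDES FOR COVERAGE rows 12–13 (trivial scale, E-8) AND rows 22–23 (fixed-`w` band at the main scale) — those rows stay as landed; CONDITIONAL on E-004 (true band; expected TRUE — band height `≲ 𝓛⁻⁸`); C4 `familyWallZeroTrueBand_inClass_triangle` (same class); the E-004 SEAM of BARRIER-STATE §2 = «a main term inside the `(1+o(1))·α̃`-band of a wall-vanishing smooth profile» and nothing else |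
| 36 «wall0top, true band» | `familyWallZeroTopTrueBand` | `WallZeroTopDesign (d, θ)` = rows 13 / 23 UNCHANGED | same at the main scale, FULL polynomial: ∀ `A` ∀ `η`, slot ⇒ eventually under (b), for EVERY `N ≥ ⌈P⌉`, the same `¬ (… < |discMean N − discMean ⌈P⌉|)` | `DiscMeanTrueBand c′ (1058+2A) η` (c) · `Re ρ = ½` (b) | p470415 | SUPERSEDES rows 13 / 23 FOR COVERAGE; `rplus_wallZeroTrueBand_decided` is the slice file's `R⁺ ++ [35, 36]` |

The B-len intake constructors `wall0` / `wall0Main` (RepairIntakeBlen v1 / v2) have these classes EXACTLY; whether the word's books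
want true-band twin constructors (`blenWord4`) is ls-barrier-plan g1's call — the rows are in the class of record either way. -/

/-- **`R⁺⁺`, version 10**: version 9 followed by the two TRUE-BAND wall-zero families (`familyWallZeroTrueBand`,
`familyWallZeroTopTrueBand`, p470415) — rows 35–36: E-004 in its final form (a slot on the true `α̃`-band only).
[cite: Zhang2022LandauSiegel, §2 (2.16)–(2.20), (2.30)–(2.33); §8 Lemma 8.1] -/
def Rplusplus10 : List DesignFamily := Rplusplus9 ++ [familyWallZeroTrueBand, familyWallZeroTopTrueBand]

/-- **Version 10 is decided**: `rplusplus9_decided` for rows 1–34 and the two landed `…_decided` theorems (p470415) for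
rows 35–36; nothing re-proved. [cite: Zhang2022LandauSiegel, §2 Props. 2.4–2.6, (2.16)–(2.20), (2.32)–(2.33); §8 Lemma 8.1] -/
theorem rplusplus10_decided : ClassDecided Rplusplus10 :=
  classDecided_append.2 ⟨rplusplus9_decided,
    classDecided_cons familyWallZeroTrueBand_decided <| classDecided_cons familyWallZeroTopTrueBand_decided classDecided_nil⟩

/-- The families of version 10, by name (the class is EXACTLY these thirty-six).
[cite: Zhang2022LandauSiegel, §2 (2.32)–(2.33)] -/
theorem mem_rplusplus10_iff (F : DesignFamily) :
    F ∈ Rplusplus10 ↔ F = familyR ∨ F = familyH1 ∨ F = familyTwoPiece ∨ F = familyFarPiece ∨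
      F = familyRWide ∨ F = familyRCalc ∨ F = KnifeEdge.familyRoughTwoPiece ∨ F = familyRLengths ∨
      F = familySmoothLengths ∨ F = familySmoothTop ∨ F = familyTwoPieceJoint ∨ F = familyWallZero ∨
      F = familyWallZeroTop ∨ F = familyInPrintLen ∨ F = KnifeEdge.familyWallBand ∨ F = familyJumpBlockAll ∨
      F = familyDetShift ∨ F = KnifeEdge.familyRoughThreePiece ∨ F = KnifeEdge.familyRoughTwoPieceJoint ∨
      F = familyFarBV ∨ F = familyLambdaBlockAll ∨ F = familyWallZeroMain ∨ F = familyWallZeroTopMain ∨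
      F = KnifeEdge.familyGramBlockAll ∨ F = familyLambdaOverhangAll ∨ F = familyLambdaGradedAll ∨
      F = KnifeEdge.familyGramBlockDict ∨ F = KnifeEdge.familyGramBordered ∨ F = familyMuPsiOverhangAll ∨
      F = familyNuOverhangAll ∨ F = familyBandEdge ∨ F = familySmoothBandEdge ∨ F = familySmoothTopBandEdge ∨
      F = familyNuLipOverhangAll ∨ F = familyWallZeroTrueBand ∨ F = familyWallZeroTopTrueBand := by
  simp only [Rplusplus10, Rplusplus9, Rplusplus8, Rplusplus7, Rplusplus6, Rplusplus5, Rplusplus4, Rplusplus3, Rplusplus2,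
    Rplusplus1, Rplus, List.cons_append, List.nil_append, List.mem_cons, List.not_mem_nil, or_false]

/-- **Version 9 ⊆ version 10** (list prefix: no family dropped). [cite: Zhang2022LandauSiegel, §2 (2.32)–(2.33)] -/
theorem rplusplus9_sub_rplusplus10 : ∀ F ∈ Rplusplus9, F ∈ Rplusplus10 :=
  fun _ hF => List.mem_append.2 (Or.inl hF)

/-- `R⁺ ⊆` version 10. [cite: Zhang2022LandauSiegel, §2 (2.32)–(2.33)] -/
theorem rplus_sub_rplusplus10 : ∀ F ∈ Rplus, F ∈ Rplusplus10 :=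
  fun F hF => rplusplus9_sub_rplusplus10 F (rplus_sub_rplusplus9 F hF)

/-- Version 10 restricted to version 9, and the slice file's own `R⁺ ++ [35, 36]` (`rplus_wallZeroTrueBand_decided`) as a
sub-list. [cite: Zhang2022LandauSiegel, §2 (2.32)–(2.33)] -/
theorem rplusplus10_decided_sublists :
    ClassDecided Rplusplus9 ∧ ClassDecided (Rplus ++ [familyWallZeroTrueBand, familyWallZeroTopTrueBand]) := by
  refine ⟨rplusplus10_decided.mono rplusplus9_sub_rplusplus10, rplusplus10_decided.mono fun F hF => ?_⟩
  rcases List.mem_append.1 hF with h | h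
  · exact rplus_sub_rplusplus10 F h
  · simp only [List.mem_cons, List.not_mem_nil, or_false] at h
    rw [mem_rplusplus10_iff]
    tauto

/-- **Both intake lists of record (v6 / v3) are inside version 10** (inherited from version 9).
[cite: Zhang2022LandauSiegel, §2 (2.32)–(2.33)] -/
theorem rplusplus10_words_sub :
    (∀ F ∈ bmultiWord6, F ∈ Rplusplus10) ∧ (∀ F ∈ blenWord3, F ∈ Rplusplus10) :=
  ⟨fun F hF => rplusplus9_sub_rplusplus10 F (bmultiWord6_sub_rplusplus9 F hF),
    fun F hF => rplusplus9_sub_rplusplus10 F (blenWord3_sub_rplusplus9 F hF)⟩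

/-- **The four wall-zero readings have ONE class** (rows 12 / 22 / 35 on `WallZeroDesign`, rows 13 / 23 / 36 on
`WallZeroTopDesign`): only the slot in the verdict differs (trivial scale / fixed-`w` main scale / true band) — the
bookkeeping behind «35–36 supersede 12–13 and 22–23 for coverage; all kept». [cite: Zhang2022LandauSiegel, §2 (2.16)–(2.20)] -/
theorem wallZeroTrueBand_sameClass :
    (∀ d : WallZeroDesign, familyWallZeroTrueBand.InClass d ↔ familyWallZero.InClass d) ∧
      (∀ d : WallZeroDesign, familyWallZeroTrueBand.InClass d ↔ familyWallZeroMain.InClass d) ∧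
      (∀ d : WallZeroTopDesign, familyWallZeroTopTrueBand.InClass d ↔ familyWallZeroTop.InClass d) ∧
      (∀ d : WallZeroTopDesign, familyWallZeroTopTrueBand.InClass d ↔ familyWallZeroTopMain.InClass d) :=
  ⟨fun _ => Iff.rfl, fun _ => Iff.rfl, fun _ => Iff.rfl, fun _ => Iff.rfl⟩

/-- **Unbundled reading of rows 35–36** (every binder literal): the two true-band verdicts with their one slot displayed.
[cite: Zhang2022LandauSiegel, §2 (2.16)–(2.20), (2.30)–(2.31); §8 Lemma 8.1] -/
theorem rplusplus10_verdicts :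
    (∀ (c' : ℝ) (g : ℝ → ℂ), LipschitzWith 1 g → (∀ z, ‖g z‖ ≤ 1) → g 1 = 0 →
        (WallZeroDesign.mk c' g).VerdictTrueBand) ∧
    (∀ (d : WallZeroDesign) (θ : ℝ), d.InClass → (∀ z, θ ≤ z → d.g z = 0) →
        (WallZeroTopDesign.mk d θ).VerdictTrueBand) :=
  ⟨fun c' g h1 h2 h3 => familyWallZeroTrueBand_decided ⟨c', g⟩ ⟨h1, h2, h3⟩,
    fun d θ hd hθ => familyWallZeroTopTrueBand_decided ⟨d, θ⟩ ⟨hd, hθ⟩⟩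

/-! ### Version 11 (2026-08-26): the true-band rows for the GLUED smooth wall-zero class (p471890, ls-barrier-p2 g2's close-out)

| # | family (decl) | designs, K in words | V (currency) | displayed inputs (kind) | p-id (file) | non-vacuity / tightness / embeddings |
|---|---|---|---|---|---|---|
| 37 «glued wall0, true band» | `familySmoothWallZeroTrueBand` | `SmoothDesign (c′, K, M, g)` with `d.InClass ∧ g(1) = 0`: the GLUED smooth wall-zero class — ANY bulk below the wall (nothing asked of `g` on `[0,1)`), overhang `K`-Lipschitz with `‖g‖ ≤ M` on `[1, ∞)`, wall value `g(1) = 0`; from the wall to any bounded length (⊇ rows 12/22/35 with `K = M = 1`: `inClassWall0_ofWallZero`) | discrete mean at the MAIN scale: ∀ `δ > 0` ∀ `A` ∀ `η`, IF `DiscMeanTrueBandKM c′ K M (1058+2A) η` then eventually under (b), for EVERY `⌈P⌉ ≤ N ≤ ⌈P^{1+δ}⌉`: `¬ (η·(discMeanAbs⌈P⌉ + 𝔞𝔓) + (𝓛^A)⁻¹·(discMeanAbs(bandEdge) + max(K,M)²·discWeight) < |discMean N − discMean ⌈P⌉|)` | ONE slot, kind (c): `Repair.DiscMeanTrueBandKM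 c′ K M m η` = E-004 on the TRUE `α̃`-band for the glued class `GluedWallZeroClass K M` at the main scale (price: derivation-OPEN / E*-len-type, BARRIER-STATE v0.55 §2) · `Re ρ = ½` (b); beyond the band edge a theorem (row 32, p470027) | p471890 (`RepairSmoothTrueBand`, ls-barrier-p2 g2) ← p470415, p470027 | C4 = the CLASS-TEXT design `u ⊕ v` for ANY bulk `u` (`inClassWall0_glue`: `v` `K`-Lipschitz, `‖v‖ ≤ M` on `[1,θ]`, `v(1) = v(θ) = 0`); C2 `inClassWall0_ofWallZero`; CONDITIONAL on E-004 (true band, glued class); p2's row text: «GLUED smooth wall-zero class … from the wall to any length, disc-mean currency; ONE slot (c) = E-004 on the TRUE α̃-band for the glued class at the main scale + (b); beyond the band edge a theorem» |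
| 38 «glued wall0top, true band» | `familySmoothTopWallZeroTrueBand` | `SmoothTopDesign` with `d.InClass ∧ g(1) = 0` (glued class + declared top `θ`, `g = 0` on `[θ, ∞)`; ⊇ rows 13/23/36 via `inClassWall0_ofWallZeroTop`) | same at the main scale, FULL polynomial: ∀ `A` ∀ `η`, slot ⇒ eventually under (b), for EVERY `N ≥ ⌈P⌉` | `DiscMeanTrueBandKM c′ K M (1058+2A) η` (c) · `Re ρ = ½` (b) | p471890 | C4 `inClassWall0_glue`; `rplus_smoothWallZeroTrueBand_decided` is the slice file's `R⁺ ++ [37, 38]`; with rows 31–38 the smooth wall-zero classes (global or glued) are covered at EVERY length from the wall with the E-004 seam confined to the true `α̃`-band |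

ERRATUM carried (C1 NOTES, append-only): in the version-8 table (RepairRplusPlus3) row 27's p-id reads «p469455 (Parts 7–10)»; the
dictionary row `KnifeEdge.familyGramBlockDict` is p468564 (RepairGramBlock Part 9), `familyGramBordered` is p469455 (Part 10),
Parts 7–8 are p468343. REF-E since version 10: E-16 / E-17 PASS (rows 29–30, verdict 33), E-20 PASS (row 34, verdict 34; its
Part 6 now types the νψ variants «ν·log n» and `(P_j/n)^{b/log P}` as members — the uncovered νψ sub-word of record shrinks to
«ν∗(smooth)» + fixed-exponent twist + jumps / wall values outside row 30). Class of record before this version = `Rplusplus10`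
(ls-barrier-plan g1 22:26:24Z (1)); the §6 D1 sentence `Repair.doneCondition_v10` (S-E-p5-5, ls-barrier-p5 g3) consumes
`rplusplus10_decided` + `rplusplus10_words_sub` — untouched here. Next version = the B-det intake at the det word (ruling
22:52:57Z (3)). -/

/-- **`R⁺⁺`, version 11**: version 10 followed by the two TRUE-BAND families of the GLUED smooth wall-zero class
(`familySmoothWallZeroTrueBand`, `familySmoothTopWallZeroTrueBand`, p471890) — rows 37–38.
[cite: Zhang2022LandauSiegel, §2 (2.16)–(2.20), (2.30)–(2.33); §8 Lemma 8.1] -/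
def Rplusplus11 : List DesignFamily := Rplusplus10 ++ [familySmoothWallZeroTrueBand, familySmoothTopWallZeroTrueBand]

/-- **Version 11 is decided**: `rplusplus10_decided` for rows 1–36 and the two landed `…_decided` theorems (p471890) for
rows 37–38; nothing re-proved. [cite: Zhang2022LandauSiegel, §2 Props. 2.4–2.6, (2.16)–(2.20), (2.32)–(2.33); §8 Lemma 8.1] -/
theorem rplusplus11_decided : ClassDecided Rplusplus11 :=
  classDecided_append.2 ⟨rplusplus10_decided,
    classDecided_cons familySmoothWallZeroTrueBand_decided <|
      classDecided_cons familySmoothTopWallZeroTrueBand_decided classDecided_nil⟩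

/-- The families of version 11, by name (the class is EXACTLY these thirty-eight).
[cite: Zhang2022LandauSiegel, §2 (2.32)–(2.33)] -/
theorem mem_rplusplus11_iff (F : DesignFamily) :
    F ∈ Rplusplus11 ↔ F = familyR ∨ F = familyH1 ∨ F = familyTwoPiece ∨ F = familyFarPiece ∨
      F = familyRWide ∨ F = familyRCalc ∨ F = KnifeEdge.familyRoughTwoPiece ∨ F = familyRLengths ∨
      F = familySmoothLengths ∨ F = familySmoothTop ∨ F = familyTwoPieceJoint ∨ F = familyWallZero ∨
      F = familyWallZeroTop ∨ F = familyInPrintLen ∨ F = KnifeEdge.familyWallBand ∨ F = familyJumpBlockAll ∨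
      F = familyDetShift ∨ F = KnifeEdge.familyRoughThreePiece ∨ F = KnifeEdge.familyRoughTwoPieceJoint ∨
      F = familyFarBV ∨ F = familyLambdaBlockAll ∨ F = familyWallZeroMain ∨ F = familyWallZeroTopMain ∨
      F = KnifeEdge.familyGramBlockAll ∨ F = familyLambdaOverhangAll ∨ F = familyLambdaGradedAll ∨
      F = KnifeEdge.familyGramBlockDict ∨ F = KnifeEdge.familyGramBordered ∨ F = familyMuPsiOverhangAll ∨
      F = familyNuOverhangAll ∨ F = familyBandEdge ∨ F = familySmoothBandEdge ∨ F = familySmoothTopBandEdge ∨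
      F = familyNuLipOverhangAll ∨ F = familyWallZeroTrueBand ∨ F = familyWallZeroTopTrueBand ∨
      F = familySmoothWallZeroTrueBand ∨ F = familySmoothTopWallZeroTrueBand := by
  simp only [Rplusplus11, Rplusplus10, Rplusplus9, Rplusplus8, Rplusplus7, Rplusplus6, Rplusplus5, Rplusplus4,
    Rplusplus3, Rplusplus2, Rplusplus1, Rplus, List.cons_append, List.nil_append, List.mem_cons, List.not_mem_nil, or_false]

/-- **Version 10 ⊆ version 11** (list prefix: no family dropped). [cite: Zhang2022LandauSiegel, §2 (2.32)–(2.33)] -/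
theorem rplusplus10_sub_rplusplus11 : ∀ F ∈ Rplusplus10, F ∈ Rplusplus11 :=
  fun _ hF => List.mem_append.2 (Or.inl hF)

/-- `R⁺ ⊆` version 11. [cite: Zhang2022LandauSiegel, §2 (2.32)–(2.33)] -/
theorem rplus_sub_rplusplus11 : ∀ F ∈ Rplus, F ∈ Rplusplus11 :=
  fun F hF => rplusplus10_sub_rplusplus11 F (rplus_sub_rplusplus10 F hF)

/-- Version 11 restricted to version 10, and the slice file's own `R⁺ ++ [37, 38]` (`rplus_smoothWallZeroTrueBand_decided`)
as a sub-list. [cite: Zhang2022LandauSiegel, §2 (2.32)–(2.33)] -/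
theorem rplusplus11_decided_sublists :
    ClassDecided Rplusplus10 ∧ ClassDecided (Rplus ++ [familySmoothWallZeroTrueBand, familySmoothTopWallZeroTrueBand]) := by
  refine ⟨rplusplus11_decided.mono rplusplus10_sub_rplusplus11, rplusplus11_decided.mono fun F hF => ?_⟩
  rcases List.mem_append.1 hF with h | h
  · exact rplus_sub_rplusplus11 F h
  · simp only [List.mem_cons, List.not_mem_nil, or_false] at h
    rw [mem_rplusplus11_iff]
    tauto

/-- **Both intake lists of record (v6 / v3) are inside version 11** (inherited).
[cite: Zhang2022LandauSiegel, §2 (2.32)–(2.33)] -/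
theorem rplusplus11_words_sub :
    (∀ F ∈ bmultiWord6, F ∈ Rplusplus11) ∧ (∀ F ∈ blenWord3, F ∈ Rplusplus11) :=
  ⟨fun F hF => rplusplus10_sub_rplusplus11 F (rplusplus10_words_sub.1 F hF),
    fun F hF => rplusplus10_sub_rplusplus11 F (rplusplus10_words_sub.2 F hF)⟩

/-- **The glued rows CONTAIN the global wall-zero rows** (C2 by term: `K = M = 1`), so rows 35–38 read the same E-004
true-band slot on nested classes. [cite: Zhang2022LandauSiegel, §7 (7.2) p.44] -/
theorem wallZero_into_glued :
    (∀ d : WallZeroDesign, d.InClass → familySmoothWallZeroTrueBand.InClass (SmoothDesign.mk d.c' 1 1 d.g)) ∧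
      (∀ d : WallZeroTopDesign, d.InClass →
        familySmoothTopWallZeroTrueBand.InClass (SmoothTopDesign.mk ⟨d.c', 1, 1, d.g⟩ d.θ)) :=
  ⟨inClassWall0_ofWallZero, inClassWall0_ofWallZeroTop⟩

/-- **Unbundled reading of rows 37–38** (every class binder literal).
[cite: Zhang2022LandauSiegel, §2 (2.16)–(2.20), (2.30)–(2.31); §8 Lemma 8.1] -/
theorem rplusplus11_verdicts :
    (∀ d : SmoothDesign, d.InClass → d.g 1 = 0 → d.VerdictTrueBand) ∧
      (∀ d : SmoothTopDesign, d.InClass → d.g 1 = 0 → d.VerdictTrueBand) :=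
  ⟨fun d h h0 => familySmoothWallZeroTrueBand_decided d ⟨h, h0⟩,
    fun d h h0 => familySmoothTopWallZeroTrueBand_decided d ⟨h, h0⟩⟩

end Repair

end Literature.NumberTheory.LFunctions.Zhang2022
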